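import Mathlib.MeasureTheory.Measure.Haar.Unique
import Literature.Probability.LatticeModels.MMPInequality
import Literature.Probability.LatticeModels.GinibreInequality
import Literature.Probability.LatticeModels.PlaneRotatorTorusBondSymmetry
import Literature.Probability.LatticeModels.PlaneRotatorHelicityModulus
import Literature.Probability.LatticeModels.PlaneRotatorTwistInequality
import HarnessLib

/-!
# The wired energy ceiling of the plane rotator: wired boundary conditions dominate, and
# `E_L(K) ≤ E^{wired}_3(K)` — the bond energy of the XY model on `(ℤ/Lℤ)²` is at most its value in the
# two-spin system in which every other rotator is identified with one ghost spin

Topic `Literature/Probability/LatticeModels` (classical comparison model of the `hubbard-tc` cell; companion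
of `PlaneRotatorHelicityModulus.lean`, `PlaneRotatorTwistInequality.lean`,
`PlaneRotatorEnergyRenormalizedDecay.lean`). The tree bounds the torus helicity modulus of the plane rotator
by the f-sum rule, `βΥ_L(K) ≤ K·E_L(K)` (`torusXYStiffness_le_energy`, Fisher–Barber–Jasnow 1973 §II), and
the bond energy `E_L(K) = ⟨cos(θ_{z+eᵢ} − θ_z)⟩_{K,L}` by the single-site Ward identity,
`E_L(K) ≤ 8K/(1 + 8K)` (`torusXYBondEnergy_le`, Aizenman–Simon), whose spin-wave deficit `1/(8K)` is half
of the true `1/(4K)`. This file proves a DIFFERENT, volume-uniform ceiling, sharper at every coupling: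

  **`E_L(K) ≤ E^{wired}_3(K)`**, `E^{wired}_m(K) := ⟨cos(θ₁ − θ₀)⟩` of TWO rotators coupled with strength `K`
  to each other and with strength `m·K` each to a frozen ghost spin
  (`= Σ_n I_n'(K) I_n(3K)² / Σ_n I_n(K) I_n(3K)²`; spin-wave deficit `1/(5K)`; at `K = 1.12`:
  `0.807` against `0.900` [float, not used]),

hence **`βΥ_L(K) ≤ K·E^{wired}_3(K)`** for all `L ≥ 3`, `K ≥ 0`, and — under the Kosterlitz–Thouless stability
HYPOTHESIS `StableBelow` of the T1 file — `T_c ≤ J/K₀` for every `K₀` at which `K₀·E^{wired}_3(K₀) < 2/π` is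
certified (`≈ J/0.8603 = 1.1624·J` [float] against `1.3448·J` from the Ward ceiling; the decimal leg is a
separate file).

## The mechanism: wired boundary conditions dominate (Ginibre / Messager–Miracle-Solé–Pfister)

For ANY finite bond system `G` at uniform coupling `β ≥ 0`, any inside set `S` of sites, a ghost site
`g ∉ S` and `x, y ∈ S` (`BondSystem.expect_cosDiff_le_wired`):

  `⟨cos(θ_x − θ_y)⟩_β ≤ ⟨cos(θ_x − θ_y)⟩^{wired(S)}_β`,

where the **wired system** `G.wired S g` keeps the bonds touching `S` and re-attaches every outside
endpoint to the single ghost `g` (all outside rotators identified). This is the plane-rotator form of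
"correlations increase under wiring" (Ginibre 1970, Model 3 p. 322 with Prop. 3: every `⟨cos(m·θ)⟩` is
non-decreasing in the ferromagnetic couplings; the Ising template is Friedli–Velenik Thm 3.20 / Exercise 3.9),
proved here WITHOUT an infinite-coupling limit, by CONDITIONING: for a frozen outside configuration `η` the
conditional law of the inside spins is the wired system with BOND PHASES `u_a(η) = η_z` on the ghost bonds
(`wiredPhase`, `weight_configSplice`), and the Messager–Miracle-Solé–Pfister inequality — phases only lower
`⟨cos(θ_x − θ_y)⟩` (tree `BondSystem.expect_cosDiff_le_expect_one`, Garban–Spencer 2022 Remark 1 / Appendix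
Thm 7.1) — bounds every conditional expectation by the unphased (= wired) one; integrating back over `η`
gives the claim. The measure theory is two changes of variables on the torus `U(1)^V`: the **configSplice**
`(ζ, η) ↦ (ζ on S, η off S)` is a continuous surjective homomorphism `U(1)^V × U(1)^V → U(1)^V`, hence
Haar-measure preserving (Mathlib `MonoidHom.measurePreserving`) — this is block Fubini
(`integral_eq_integral_integral_configSplice`) — and a rotation of the inside spins removes the ghost's angle
(`integral_cosDiff_mul_weight_wired_eq`).

## Main statements

* §1 `configSplice`, `measurePreserving_configSplice`, `integral_eq_integral_integral_configSplice` (block Fubini on `U(1)^V`).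
* §2 `BondSystem.wired`, `wiredPhase`, `farEnergy`, `weight_configSplice` (**conditional weight = phased wired weight ×
  far weight**), `weight_wired_configSplice`, `integral_cosDiff_mul_weight_wired_eq`, and
  **`BondSystem.expect_cosDiff_le_wired`** (wired domination, any bond system).
* §3 `energy_wired_one`: the unphased wired energy is the energy of "`ζ` inside, `1` outside" minus the number of
  far bonds.
* §4 Torus `(ℤ/Lℤ)²`, `L ≥ 3`: `torusXYBondEnergy_eq_expect`, `torusXYBondEnergy_le_expect_wired`,
  `torusXY_energy_configSplice_pair_one` (the torus energy of a configuration supported on one bond: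
  `2L² − 7 + cos(θ_y − θ_x) + 3cos θ_x + 3cos θ_y`), the **wired two-spin system** on `U(1)^{Fin 2}`
  (`wiredPairChar`, `wiredPairCoupling K m = (K, mK, mK)`, **`wiredPairEnergy K m`** a Ginibre expectation),
  `pairRestrict` / `measurePreserving_pairRestrict` (two distinct coordinates of a uniform configuration are
  independent uniform angles), `expect_wired_pair_eq_wiredPairEnergy`, and the deciding theorems
  **`torusXYBondEnergy_le_wiredPairEnergy`** (`E_L(K) ≤ E^{wired}_3(K)`),
  **`torusXYStiffness_le_mul_wiredPairEnergy`** (`βΥ_L(K) ≤ K·E^{wired}_3(K)`), `mul_torusXYStiffness_le_wired`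
  (`Υ_L(T) ≤ J·E^{wired}_3(J/T)`).
* §5 `wiredPairEnergy_nonneg`, `wiredPairEnergy_le_one`, **`wiredPairEnergy_mono`** (Ginibre on `U(1)²`), and
  the K2-CONDITIONAL readings `kt_le_of_stableBelow_of_wiredCeiling`,
  `kt_le_of_stableBelow_of_tendsto_torusXYStiffness_wired`: `StableBelow ρ T_c`, `ρ` dominated by (limits
  of) `Υ_L`, and a certified `K₀·E^{wired}_3(K₀) < 2/π` give **`T_c ≤ J/K₀`**.

WHAT THIS IS NOT: a statement about the Hubbard model or any material; no number of record of the cell moves;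
the Kosterlitz–Thouless stability inequality stays a NAMED HYPOTHESIS (`StableBelow`); the numerical value of
`E^{wired}_3` is not certified in this file (only its definition, monotonicity and `0 ≤ E ≤ 1`).

## References

* J. Ginibre, *General formulation of Griffiths' inequalities*, Comm. Math. Phys. 16 (1970) 310–328, Model 3
  (plane rotators) p. 322 and Prop. 3. [Ginibre1970]
* A. Messager, S. Miracle-Solé, C. Pfister, *Correlation inequalities and uniqueness of the equilibrium state
  for the plane rotator ferromagnetic model*, Comm. Math. Phys. 58 (1978) 19–29. [MessagerMiraclesolePfister1978]
* C. Garban, T. Spencer, *Continuous symmetry breaking along the Nishimori line*, J. Math. Phys. 63 (2022)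
  093302 = arXiv:2109.01617, Remark 1 and Appendix Thm 7.1 (arXiv Thm 21). [GarbanSpencer2022]
* S. Friedli, Y. Velenik, *Statistical Mechanics of Lattice Systems* (CUP 2017), Thm 3.20, Exercise 3.9 (the
  Ising template: `⟨σ_A⟩⁺` increasing in the couplings). [FriedliVelenik2017]
* M. E. Fisher, M. N. Barber, D. Jasnow, Phys. Rev. A 8 (1973) 1111, §II (helicity modulus).
  [FisherBarberJasnow1973]
* D. R. Nelson, *Defects and Geometry in Condensed Matter Physics* (CUP 2002), §2.2.2 (2.44)–(2.47) (the
  stability inequality, consumed as hypothesis). [Nelson2002Defects]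
-/

noncomputable section

open MeasureTheory Filter Finset
open scoped Topology BigOperators ComplexConjugate

namespace Literature.Probability.LatticeModels

/-! ## §1 Splicing two configurations along an inside set; block Fubini on the torus `U(1)^V` -/

section Splice

variable {V : Type*} [DecidableEq V]

/-- The **configSplice** of two spin configurations along an inside set `S`: `configSplice S (ζ, η)` agrees with
`ζ` on `S` and with `η` off `S` (the concatenation `ζ_S η_{Sᶜ}` of Friedli–Velenik §6.3.2). It is a group
homomorphism `U(1)^V × U(1)^V → U(1)^V` (pointwise multiplication). [cite: FriedliVelenik2017, §6.3.2 eqs. (6.29)–(6.30) and Lemma 6.15 (concatenation τ_Λ ω_{Λᶜ} of an inside and an outside configuration; Gibbsian specification)] -/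
def configSplice (S : Finset V) : (V → Circle) × (V → Circle) →* (V → Circle) where
  toFun p := fun v => if v ∈ S then p.1 v else p.2 v
  map_one' := by
    funext v
    simp
  map_mul' p q := by
    funext v
    by_cases hv : v ∈ S <;> simp [hv]

/-- Pointwise form of the configSplice. [folklore] -/
private theorem configSplice_apply (S : Finset V) (p : (V → Circle) × (V → Circle)) (v : V) :
    configSplice S p v = if v ∈ S then p.1 v else p.2 v := rfl

/-- On the inside set the configSplice reads the first configuration. [folklore] -/
@[simp] private theorem configSplice_apply_of_mem {S : Finset V} {v : V} (hv : v ∈ S) (ζ η : V → Circle) :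
    configSplice S (ζ, η) v = ζ v := by
  rw [configSplice_apply, if_pos hv]

/-- Off the inside set the configSplice reads the second configuration. [folklore] -/
@[simp] private theorem configSplice_apply_of_not_mem {S : Finset V} {v : V} (hv : v ∉ S) (ζ η : V → Circle) :
    configSplice S (ζ, η) v = η v := by
  rw [configSplice_apply, if_neg hv]

/-- The configSplice is continuous. [folklore] -/
private theorem continuous_configSplice (S : Finset V) :
    Continuous (configSplice S : (V → Circle) × (V → Circle) → V → Circle) := by
  refine continuous_pi fun v => ?_
  by_cases hv : v ∈ S
  · simp only [configSplice_apply, hv, if_true]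
    exact (continuous_apply v).comp continuous_fst
  · simp only [configSplice_apply, hv, if_false]
    exact (continuous_apply v).comp continuous_snd

/-- The configSplice is surjective (`configSplice S (θ, θ) = θ`). [folklore] -/
private theorem configSplice_surjective (S : Finset V) :
    Function.Surjective (configSplice S : (V → Circle) × (V → Circle) → V → Circle) := fun θ =>
  ⟨(θ, θ), funext fun v => by by_cases hv : v ∈ S <;> simp [configSplice_apply, hv]⟩

/-- Splicing a configuration with itself off `S` after a constant rotation: for `v ∈ S`,
`configSplice S (ζ·c, η) v = ζ v · c`. [folklore] -/
private theorem configSplice_mul_const_apply_of_mem {S : Finset V} {v : V} (hv : v ∈ S) (ζ η : V → Circle)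
    (c : Circle) : configSplice S (ζ * fun _ => c, η) v = ζ v * c := by
  rw [configSplice_apply_of_mem hv]; rfl

variable [Fintype V] [MeasurableSpace Circle] [BorelSpace Circle]

/-- **The configSplice preserves the Haar measure**: the image of `dζ ⊗ dη` under `(ζ, η) ↦ configSplice S (ζ, η)`
is `dθ` — a continuous surjective homomorphism onto a compact group carries Haar probability measure to
Haar probability measure (Mathlib `MonoidHom.measurePreserving`); coordinatewise this is just the fact
that picking each coordinate from one of two independent uniform angles gives independent uniform
angles (the product structure of the a-priori measure in Friedli–Velenik §6.3.2). [cite: FriedliVelenik2017, §6.3.2 eqs. (6.29)–(6.30) and Lemma 6.15 (concatenation τ_Λ ω_{Λᶜ} of an inside and an outside configuration; Gibbsian specification)] -/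
theorem measurePreserving_configSplice (S : Finset V) :
    MeasurePreserving (configSplice S) ((torusHaar V).prod (torusHaar V)) (torusHaar V) :=
  MonoidHom.measurePreserving (continuous_configSplice S) (configSplice_surjective S)
    (by rw [measure_univ, measure_univ])

/-- **Block Fubini on the torus.** For a continuous `F` and any inside set `S`:
`∫ F(θ) dθ = ∫ dη ∫ dζ F(configSplice S (ζ, η))` — integrate first over the inside coordinates (read from
`ζ`), then over the outside ones (read from `η`); the unused coordinates of `ζ` and `η` integrate to `1`
(the finite-volume form of "integrate the inside spins at fixed boundary condition", Friedli–Velenik §6.3.2).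
[cite: FriedliVelenik2017, §6.3.2 eqs. (6.29)–(6.30) and Lemma 6.15 (concatenation τ_Λ ω_{Λᶜ} of an inside and an outside configuration; Gibbsian specification)] -/
theorem integral_eq_integral_integral_configSplice (S : Finset V) {F : (V → Circle) → ℝ}
    (hF : Continuous F) :
    ∫ θ, F θ ∂torusHaar V =
      ∫ η, ∫ ζ, F (configSplice S (ζ, η)) ∂torusHaar V ∂torusHaar V := by
  have h := measurePreserving_configSplice (V := V) S
  have hi : Integrable (fun p => F (configSplice S p)) ((torusHaar V).prod (torusHaar V)) :=
    integrable_of_continuous_compactSpace _ (hF.comp (continuous_configSplice S))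
  calc ∫ θ, F θ ∂torusHaar V = ∫ p, F (configSplice S p) ∂((torusHaar V).prod (torusHaar V)) := by
        rw [← integral_map h.measurable.aemeasurable hF.aestronglyMeasurable, h.map_eq]
    _ = ∫ η, ∫ ζ, F (configSplice S (ζ, η)) ∂torusHaar V ∂torusHaar V := integral_prod_symm _ hi

/-- The inner integrals of the block Fubini formula form an integrable function of the outside
configuration. [folklore] -/
private theorem integrable_integral_configSplice (S : Finset V) {F : (V → Circle) → ℝ} (hF : Continuous F) :
    Integrable (fun η => ∫ ζ, F (configSplice S (ζ, η)) ∂torusHaar V) (torusHaar V) := by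
  have hi : Integrable (fun p => F (configSplice S p)) ((torusHaar V).prod (torusHaar V)) :=
    integrable_of_continuous_compactSpace _ (hF.comp (continuous_configSplice S))
  exact hi.integral_prod_right

end Splice

/-! ## §2 The wired system of an inside set and the comparison `⟨cos(θ_x − θ_y)⟩ ≤ ⟨cos(θ_x − θ_y)⟩^{wired}` -/

namespace BondSystem

variable {V ι : Type*} [DecidableEq V] (G : BondSystem V ι)

/-- **The wired system** of the inside set `S` with ghost site `g`: keep the bonds of `G` that touch
`S`, and re-attach every endpoint lying outside `S` to the single site `g` (all rotators outside `S`
identified with one ghost rotator). Bonds with both endpoints outside `S` are dropped. [cite: Ginibre1970, Model 3 p. 322 and Prop. 3 (plane rotators; correlations non-decreasing in the ferromagnetic couplings — the wired system as the extreme boundary condition)] -/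
def wired (S : Finset V) (g : V) : BondSystem V {a : ι // G.src a ∈ S ∨ G.tgt a ∈ S} where
  src a := if G.src a.1 ∈ S then G.src a.1 else g
  tgt a := if G.tgt a.1 ∈ S then G.tgt a.1 else g

/-- The bond phases that encode a frozen outside configuration `η` in the wired system: a bond leaving
`S` towards the outside site `z` gets the phase `η_z`, a bond entering `S` from `z` gets `η̄_z`,
inside bonds get no phase (the boundary condition as bond phases, Garban–Spencer 2022 (1.3)/(2.7)).
[cite: GarbanSpencer2022, (1.3) and (2.7) (bond phases); FriedliVelenik2017, §6.3.2 (boundary condition)] -/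
def wiredPhase (S : Finset V) (η : V → Circle) (a : {a : ι // G.src a ∈ S ∨ G.tgt a ∈ S}) : Circle :=
  (if G.tgt a.1 ∈ S then 1 else η (G.tgt a.1)) * (if G.src a.1 ∈ S then 1 else (η (G.src a.1))⁻¹)

/-- With the trivial outside configuration the wired phases are trivial. [folklore] -/
@[simp] private theorem wiredPhase_one (S : Finset V) : G.wiredPhase S 1 = 1 := by
  funext a
  simp [wiredPhase]

/-- **The conditional bond variables are the phased wired ones.** For a bond `a` touching `S`, the bond
variable of `G` in the spliced configuration `configSplice S (ζ, η)` equals the bond variable of the wired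
system, with phases `wiredPhase S η`, in the configuration `configSplice S (ζ, 1)` (inside spins `ζ`, ghost
spin `1`), provided the ghost site lies outside `S`. [folklore] -/
private theorem bondVar_wired {S : Finset V} {g : V} (hg : g ∉ S) (ζ η : V → Circle)
    (a : {a : ι // G.src a ∈ S ∨ G.tgt a ∈ S}) :
    (G.wired S g).bondVar (G.wiredPhase S η) (configSplice S (ζ, 1)) a =
      G.bondVar 1 (configSplice S (ζ, η)) a.1 := by
  obtain ⟨a, ha⟩ := a
  by_cases hs : G.src a ∈ S <;> by_cases ht : G.tgt a ∈ S
  · simp [bondVar, wired, wiredPhase, hs, ht]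
  · simp [bondVar, wired, wiredPhase, hs, ht, hg, mul_comm]
  · simp [bondVar, wired, wiredPhase, hs, ht, hg, mul_comm]
  · exact absurd ha (not_or.2 ⟨hs, ht⟩)

variable [Fintype ι]

/-- The energy of the bonds NOT touching the inside set, a function of the outside configuration (the
`Λᶜ`-part of the Hamiltonian in Friedli–Velenik (6.29)–(6.30)). [cite: FriedliVelenik2017, §6.3.2 eqs. (6.29)–(6.30) and Lemma 6.15 (concatenation τ_Λ ω_{Λᶜ} of an inside and an outside configuration; Gibbsian specification)] -/
def farEnergy (S : Finset V) (η : V → Circle) : ℝ :=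
  ∑ a ∈ univ.filter (fun a => ¬(G.src a ∈ S ∨ G.tgt a ∈ S)), ((G.bondVar 1 η a : Circle) : ℂ).re

/-- **Energy decomposition under splicing**: the energy of `G` in `configSplice S (ζ, η)` is the phased wired
energy of the inside configuration plus the far energy of the outside configuration — the splitting
`H_Λ(τ_Λ ω_{Λᶜ})` of Friedli–Velenik (6.29)–(6.30) written with bond phases. [cite: FriedliVelenik2017, §6.3.2 eqs. (6.29)–(6.30) and Lemma 6.15 (concatenation τ_Λ ω_{Λᶜ} of an inside and an outside configuration; Gibbsian specification)] -/
theorem energy_configSplice {S : Finset V} {g : V} (hg : g ∉ S) (ζ η : V → Circle) :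
    G.energy 1 (configSplice S (ζ, η)) =
      (G.wired S g).energy (G.wiredPhase S η) (configSplice S (ζ, 1)) + G.farEnergy S η := by
  classical
  unfold energy farEnergy
  rw [← Finset.sum_filter_add_sum_filter_not univ (fun a => G.src a ∈ S ∨ G.tgt a ∈ S)]
  congr 1
  · rw [Finset.sum_subtype (univ.filter fun a => G.src a ∈ S ∨ G.tgt a ∈ S)
      (p := fun a => G.src a ∈ S ∨ G.tgt a ∈ S) (fun a => by simp)]
    exact Finset.sum_congr rfl fun a _ => by rw [G.bondVar_wired hg ζ η a]
  · refine Finset.sum_congr rfl fun a ha => ?_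
    simp only [Finset.mem_filter, Finset.mem_univ, true_and, not_or] at ha
    simp [bondVar, configSplice_apply_of_not_mem ha.1, configSplice_apply_of_not_mem ha.2]

/-- **Weight factorisation under splicing**: `w_β(configSplice S (ζ, η)) = w^{wired}_{β, u(η)}(configSplice S (ζ, 1))
· exp(β·farEnergy η)` — the Gibbs weight is (conditional weight of the inside spins given the outside
configuration) × (outside weight), Friedli–Velenik Lemma 6.15. [cite: FriedliVelenik2017, §6.3.2 eqs. (6.29)–(6.30) and Lemma 6.15 (concatenation τ_Λ ω_{Λᶜ} of an inside and an outside configuration; Gibbsian specification)] -/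
theorem weight_configSplice (β : ℝ) {S : Finset V} {g : V} (hg : g ∉ S) (ζ η : V → Circle) :
    G.weight β 1 (configSplice S (ζ, η)) =
      (G.wired S g).weight β (G.wiredPhase S η) (configSplice S (ζ, 1)) *
        Real.exp (β * G.farEnergy S η) := by
  rw [weight, weight, G.energy_configSplice hg, mul_add, Real.exp_add]

omit [Fintype ι] in
/-- The wired system sees only `S ∪ {g}`, and its bond variables are invariant under a global rotation:
replacing the outside configuration `η'` of a configSplice by the trivial one costs a rotation of the inside
spins by `(η'_g)⁻¹`. [folklore] -/
private theorem bondVar_wired_configSplice {S : Finset V} {g : V} (hg : g ∉ S)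
    (u : {a : ι // G.src a ∈ S ∨ G.tgt a ∈ S} → Circle) (ζ η' : V → Circle)
    (a : {a : ι // G.src a ∈ S ∨ G.tgt a ∈ S}) :
    (G.wired S g).bondVar u (configSplice S (ζ, η')) a =
      (G.wired S g).bondVar u (configSplice S (ζ * fun _ => (η' g)⁻¹, 1)) a := by
  -- every site read by the wired system is in `S ∪ {g}`, where the second configuration is the
  -- first one rotated by `(η' g)⁻¹`
  have key : ∀ v, (v ∈ S ∨ v = g) →
      configSplice S (ζ * fun _ => (η' g)⁻¹, 1) v = configSplice S (ζ, η') v * (η' g)⁻¹ := by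
    rintro v (hv | rfl)
    · rw [configSplice_mul_const_apply_of_mem hv, configSplice_apply_of_mem hv]
    · rw [configSplice_apply_of_not_mem hg, configSplice_apply_of_not_mem hg, Pi.one_apply, mul_inv_cancel]
  have hsrc : (G.wired S g).src a ∈ S ∨ (G.wired S g).src a = g := by
    simp only [wired]; split_ifs with h
    · exact Or.inl h
    · exact Or.inr rfl
  have htgt : (G.wired S g).tgt a ∈ S ∨ (G.wired S g).tgt a = g := by
    simp only [wired]; split_ifs with h
    · exact Or.inl h
    · exact Or.inr rfl
  rw [bondVar, bondVar, key _ hsrc, key _ htgt, mul_inv, inv_inv]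
  simp only [mul_assoc, mul_comm, mul_left_comm, mul_inv_cancel_left]

/-- Hence the wired weight of a configSplice depends on the outside configuration only through a rotation of
the inside spins. [folklore] -/
private theorem weight_wired_configSplice (β : ℝ) {S : Finset V} {g : V} (hg : g ∉ S)
    (u : {a : ι // G.src a ∈ S ∨ G.tgt a ∈ S} → Circle) (ζ η' : V → Circle) :
    (G.wired S g).weight β u (configSplice S (ζ, η')) =
      (G.wired S g).weight β u (configSplice S (ζ * fun _ => (η' g)⁻¹, 1)) := by
  simp only [weight, energy, G.bondVar_wired_configSplice hg u ζ η']

end BondSystem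

/-- The two-point observable of two inside sites is rotation invariant and reads only `S`:
`cos(θ_x − θ_y)` at `configSplice S (ζ, η')` equals its value at `configSplice S (ζ·(η'_g)⁻¹, 1)`. [folklore] -/
private theorem cosDiff_configSplice_eq {V : Type*} [DecidableEq V] {S : Finset V} {x y : V} (hx : x ∈ S)
    (hy : y ∈ S) (g : V) (ζ η' : V → Circle) :
    cosDiff x y (configSplice S (ζ, η')) = cosDiff x y (configSplice S (ζ * fun _ => (η' g)⁻¹, 1)) := by
  rw [cosDiff, cosDiff, configSplice_apply_of_mem hx, configSplice_apply_of_mem hy,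
    configSplice_mul_const_apply_of_mem hx, configSplice_mul_const_apply_of_mem hy]
  rw [Circle.coe_mul, Circle.coe_mul, map_mul, Circle.coe_inv_eq_conj, Complex.conj_conj]
  have hc : conj ((η' g : Circle) : ℂ) * (η' g : ℂ) = 1 := by
    rw [← Circle.coe_inv_eq_conj, ← Circle.coe_mul, inv_mul_cancel, Circle.coe_one]
  congr 1
  calc conj ((ζ x : Circle) : ℂ) * (ζ y : ℂ)
      = conj ((ζ x : Circle) : ℂ) * (ζ y : ℂ) * (conj ((η' g : Circle) : ℂ) * (η' g : ℂ)) := by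
        rw [hc, mul_one]
    _ = conj ((ζ x : Circle) : ℂ) * ((η' g : Circle) : ℂ) * ((ζ y : ℂ) * conj ((η' g : Circle) : ℂ)) := by
        ring

/-- The two-point observable of two inside sites does not see the outside configuration.
[folklore] -/
private theorem cosDiff_configSplice_eq_one {V : Type*} [DecidableEq V] {S : Finset V} {x y : V} (hx : x ∈ S)
    (hy : y ∈ S) (ζ η : V → Circle) :
    cosDiff x y (configSplice S (ζ, η)) = cosDiff x y (configSplice S (ζ, 1)) := by
  rw [cosDiff, cosDiff, configSplice_apply_of_mem hx, configSplice_apply_of_mem hy, configSplice_apply_of_mem hx,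
    configSplice_apply_of_mem hy]

namespace BondSystem

variable {V ι : Type*} [Fintype V] [DecidableEq V] [Fintype ι] (G : BondSystem V ι)
  [MeasurableSpace Circle] [BorelSpace Circle]

/-- **The wired Gibbs integrals live on the inside coordinates.** For the observables `f = cos(θ_x −
θ_y)` (`x, y ∈ S`) and any bond phases `u`:
`∫ f w^{wired}_{β,u} dφ = ∫ f(configSplice S (ζ,1)) w^{wired}_{β,u}(configSplice S (ζ,1)) dζ`
(block Fubini, then the outside configuration is removed by a rotation of the inside spins, which the
Haar measure does not see). [folklore] -/
private theorem integral_cosDiff_mul_weight_wired_eq (β : ℝ) {S : Finset V} {g x y : V} (hg : g ∉ S)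
    (hx : x ∈ S) (hy : y ∈ S) (u : {a : ι // G.src a ∈ S ∨ G.tgt a ∈ S} → Circle) :
    ∫ φ, cosDiff x y φ * (G.wired S g).weight β u φ ∂torusHaar V =
      ∫ ζ, cosDiff x y (configSplice S (ζ, 1)) * (G.wired S g).weight β u (configSplice S (ζ, 1))
        ∂torusHaar V := by
  have hF : Continuous fun φ => cosDiff x y φ * (G.wired S g).weight β u φ :=
    (continuous_cosDiff x y).mul ((G.wired S g).continuous_weight β u)
  rw [integral_eq_integral_integral_configSplice S hF]
  have inner : ∀ η' : V → Circle,
      ∫ ζ, cosDiff x y (configSplice S (ζ, η')) * (G.wired S g).weight β u (configSplice S (ζ, η')) ∂torusHaar V =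
        ∫ ζ, cosDiff x y (configSplice S (ζ, 1)) * (G.wired S g).weight β u (configSplice S (ζ, 1))
          ∂torusHaar V := by
    intro η'
    rw [← integral_torusHaar_mul_right
      (fun ζ => cosDiff x y (configSplice S (ζ, 1)) * (G.wired S g).weight β u (configSplice S (ζ, 1)))
      (fun _ => (η' g)⁻¹)]
    refine integral_congr_ae (ae_of_all _ fun ζ => ?_)
    simp only
    rw [cosDiff_configSplice_eq hx hy g ζ η', G.weight_wired_configSplice β hg u ζ η']
  simp_rw [inner]
  rw [integral_const, smul_eq_mul, probReal_univ, one_mul]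

/-- The same for the observable `f = 1`: the wired partition function. [folklore] -/
private theorem integral_weight_wired_eq (β : ℝ) {S : Finset V} {g : V} (hg : g ∉ S)
    (u : {a : ι // G.src a ∈ S ∨ G.tgt a ∈ S} → Circle) :
    ∫ φ, (G.wired S g).weight β u φ ∂torusHaar V =
      ∫ ζ, (G.wired S g).weight β u (configSplice S (ζ, 1)) ∂torusHaar V := by
  have hF : Continuous fun φ => (G.wired S g).weight β u φ := (G.wired S g).continuous_weight β u
  rw [integral_eq_integral_integral_configSplice S hF]
  have inner : ∀ η' : V → Circle,
      ∫ ζ, (G.wired S g).weight β u (configSplice S (ζ, η')) ∂torusHaar V =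
        ∫ ζ, (G.wired S g).weight β u (configSplice S (ζ, 1)) ∂torusHaar V := by
    intro η'
    rw [← integral_torusHaar_mul_right (fun ζ => (G.wired S g).weight β u (configSplice S (ζ, 1)))
      (fun _ => (η' g)⁻¹)]
    refine integral_congr_ae (ae_of_all _ fun ζ => ?_)
    simp only
    rw [G.weight_wired_configSplice β hg u ζ η']
  simp_rw [inner]
  rw [integral_const, smul_eq_mul, probReal_univ, one_mul]

/-- **Wired boundary conditions dominate (Griffiths–Ginibre / Messager–Miracle-Solé–Pfister).** For the
plane rotator with uniform coupling `β ≥ 0` on any finite bond system, any inside set `S`, ghost site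
`g ∉ S` and sites `x, y ∈ S`:
`⟨cos(θ_x − θ_y)⟩_β ≤ ⟨cos(θ_x − θ_y)⟩^{wired S}_β`.
Proof: condition on the outside configuration `η` (block Fubini); the conditional law of the inside
spins is the wired system with the bond PHASES `wiredPhase S η`; by the MMP inequality
(`expect_cosDiff_le_expect_one`: phases lower correlations) each conditional expectation is at most
the unphased wired one; integrate back. [cite: GarbanSpencer2022, Remark 1 and Appendix Theorem 7.1 (MMP inequality, the input); Ginibre1970, Model 3 p. 322 and Prop. 3] -/
theorem expect_cosDiff_le_wired {β : ℝ} (hβ : 0 ≤ β) {S : Finset V} {g x y : V} (hg : g ∉ S)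
    (hx : x ∈ S) (hy : y ∈ S) :
    G.expect β 1 (cosDiff x y) ≤ (G.wired S g).expect β 1 (cosDiff x y) := by
  set W := G.wired S g with hW
  set Ew := W.expect β 1 (cosDiff x y) with hEw
  -- continuity of the integrands
  have hFc : Continuous fun θ => cosDiff x y θ * G.weight β 1 θ :=
    (continuous_cosDiff x y).mul (G.continuous_weight β 1)
  have hF1 : Continuous (G.weight β 1) := G.continuous_weight β 1
  -- the inner integrals
  set Φc : (V → Circle) → ℝ := fun η =>
    ∫ ζ, cosDiff x y (configSplice S (ζ, η)) * G.weight β 1 (configSplice S (ζ, η)) ∂torusHaar V with hΦc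
  set Φ1 : (V → Circle) → ℝ := fun η => ∫ ζ, G.weight β 1 (configSplice S (ζ, η)) ∂torusHaar V with hΦ1
  have num_eq : ∫ θ, cosDiff x y θ * G.weight β 1 θ ∂torusHaar V = ∫ η, Φc η ∂torusHaar V :=
    integral_eq_integral_integral_configSplice S hFc
  have den_eq : ∫ θ, G.weight β 1 θ ∂torusHaar V = ∫ η, Φ1 η ∂torusHaar V :=
    integral_eq_integral_integral_configSplice S hF1
  have hΦc_int : Integrable Φc (torusHaar V) := integrable_integral_configSplice S hFc
  have hΦ1_int : Integrable Φ1 (torusHaar V) := integrable_integral_configSplice S hF1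
  -- the inner integrals are phased wired Gibbs integrals times the far weight
  have hΦc_eq : ∀ η, Φc η = Real.exp (β * G.farEnergy S η) *
      ∫ φ, cosDiff x y φ * W.weight β (G.wiredPhase S η) φ ∂torusHaar V := by
    intro η
    rw [hΦc, G.integral_cosDiff_mul_weight_wired_eq β hg hx hy, ← integral_const_mul]
    refine integral_congr_ae (ae_of_all _ fun ζ => ?_)
    simp only
    rw [cosDiff_configSplice_eq_one hx hy, G.weight_configSplice β hg]
    ring
  have hΦ1_eq : ∀ η, Φ1 η = Real.exp (β * G.farEnergy S η) *
      ∫ φ, W.weight β (G.wiredPhase S η) φ ∂torusHaar V := by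
    intro η
    rw [hΦ1, G.integral_weight_wired_eq β hg, ← integral_const_mul]
    refine integral_congr_ae (ae_of_all _ fun ζ => ?_)
    simp only
    rw [G.weight_configSplice β hg]
    ring
  -- MMP, pointwise in the outside configuration
  have hpt : ∀ η, Φc η ≤ Ew * Φ1 η := by
    intro η
    have hmmp := W.expect_cosDiff_le_expect_one hβ (G.wiredPhase S η) x y
    have hZ := W.partitionFn_pos β (G.wiredPhase S η)
    rw [expect, div_le_iff₀ hZ] at hmmp
    rw [hΦc_eq, hΦ1_eq, mul_left_comm]
    exact mul_le_mul_of_nonneg_left hmmp (Real.exp_pos _).le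
  -- integrate
  have hnum_le : ∫ θ, cosDiff x y θ * G.weight β 1 θ ∂torusHaar V ≤
      Ew * ∫ θ, G.weight β 1 θ ∂torusHaar V := by
    rw [num_eq, den_eq, ← integral_const_mul]
    exact integral_mono hΦc_int (hΦ1_int.const_mul Ew) hpt
  have hZ := G.partitionFn_pos β 1
  rw [expect, div_le_iff₀ hZ]
  exact hnum_le

end BondSystem


/-! ## §3 The wired energy at the trivial outside configuration; the far bonds only shift it -/

namespace BondSystem

variable {V ι : Type*} [DecidableEq V] [Fintype ι] (G : BondSystem V ι)

/-- At the trivial outside configuration the far energy is the NUMBER of far bonds. [folklore] -/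
private theorem farEnergy_one (S : Finset V) :
    G.farEnergy S 1 = ((univ.filter fun a => ¬(G.src a ∈ S ∨ G.tgt a ∈ S)).card : ℝ) := by
  unfold farEnergy
  rw [Finset.sum_congr rfl (g := fun _ => (1 : ℝ)) fun a _ => by simp [bondVar], Finset.sum_const,
    nsmul_eq_mul, mul_one]

/-- The unphased wired energy of an inside configuration is the energy of `G` in the configuration
"inside spins `ζ`, all outside spins equal to `1`", up to the constant number of far bonds. [folklore] -/
private theorem energy_wired_one {S : Finset V} {g : V} (hg : g ∉ S) (ζ : V → Circle) :
    (G.wired S g).energy 1 (configSplice S (ζ, 1)) =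
      G.energy 1 (configSplice S (ζ, 1)) - ((univ.filter fun a => ¬(G.src a ∈ S ∨ G.tgt a ∈ S)).card : ℝ) := by
  have h := G.energy_configSplice hg ζ 1
  rw [wiredPhase_one, farEnergy_one] at h
  linarith

end BondSystem

/-! ## §4 The plane rotator on `(ℤ/Lℤ)²`: the bond energy is at most the wired two-spin energy -/

section Torus

variable {L : ℕ}

/-- The source of the torus bond `(z, i)` is `z`. [folklore] -/
private theorem torusXY_src_eq (d : ℕ) (b : TorusSite d L × Fin d) : (torusXY d L).src b = b.1 := rfl

/-- The target of the torus bond `(z, i)` is `z + eᵢ`. [folklore] -/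
private theorem torusXY_tgt_eq (d : ℕ) (b : TorusSite d L × Fin d) :
    (torusXY d L).tgt b = b.1 + Pi.single b.2 1 := rfl

/-- On `(ℤ/Lℤ)²` with `L ≥ 3` distinct directions have distinct unit vectors. [folklore] -/
private theorem torus_single_eq_single_iff (hL : 3 ≤ L) (i j : Fin 2) :
    (Pi.single j (1 : ZMod L) : TorusSite 2 L) = Pi.single i 1 ↔ j = i := by
  haveI : Fact (1 < L) := ⟨by omega⟩
  refine ⟨fun h => ?_, fun h => by rw [h]⟩
  by_contra hji
  have := congrFun h j
  simp [hji] at this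

variable [NeZero L] [MeasurableSpace Circle] [BorelSpace Circle]

/-- The bond energy of the torus is the phase-free Gibbs expectation of the two-point observable of the
bond's endpoints (bridge `ginibreExpect`/`expectJ` ↔ `expect β 1`). [cite: Ginibre1970, Example 4 (plane rotators)] -/
theorem torusXYBondEnergy_eq_expect (K : ℝ) (b : TorusSite 2 L × Fin 2) :
    torusXYBondEnergy L K b = (torusXY 2 L).expect K 1 (cosDiff b.1 (b.1 + Pi.single b.2 1)) := by
  unfold torusXYBondEnergy
  change (torusXY 2 L).expectJ (fun _ => K) _ = _
  rw [BondSystem.expectJ_eq, BondSystem.expect, BondSystem.partitionFn_one_eq_partitionFnJ]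
  congr 1
  refine integral_congr_ae (ae_of_all _ fun θ => ?_)
  simp only
  rw [BondSystem.weight_one_eq_weightJ]
  congr 1
  exact (cosDiff_eq_reChar _ _ θ).symm

/-- **Wired domination on the torus.** For `L ≥ 3`, `K ≥ 0` and every bond `b = (x, i)` of `(ℤ/Lℤ)²`,
the bond energy `E_L(K) = ⟨cos(θ_{x+eᵢ} − θ_x)⟩_{K,L}` is at most the same expectation in the wired system
of the inside set `{x, x + eᵢ}` (ghost site `x − eᵢ`). [cite: GarbanSpencer2022, Remark 1 and Appendix Theorem 7.1 (MMP inequality, the input); Ginibre1970, Model 3 p. 322 and Prop. 3] -/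
theorem torusXYBondEnergy_le_expect_wired (hL : 3 ≤ L) {K : ℝ} (hK : 0 ≤ K)
    (b : TorusSite 2 L × Fin 2) :
    torusXYBondEnergy L K b ≤
      ((torusXY 2 L).wired {b.1, b.1 + Pi.single b.2 1} (b.1 - Pi.single b.2 1)).expect K 1
        (cosDiff b.1 (b.1 + Pi.single b.2 1)) := by
  rw [torusXYBondEnergy_eq_expect]
  refine (torusXY 2 L).expect_cosDiff_le_wired hK ?_ (Finset.mem_insert_self _ _)
    (Finset.mem_insert_of_mem (Finset.mem_singleton_self _))
  -- the ghost site `x − eᵢ` is outside `{x, x + eᵢ}`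
  have h1 := torus_single_ne_zero ((by norm_num : (2 : ℕ) ≤ 3).trans hL) b.2
  have h2 := torus_single_add_single_ne_zero hL b.2 b.2
  simp only [Finset.mem_insert, Finset.mem_singleton, not_or]
  constructor
  · intro h
    exact h1 (by simpa using h)
  · intro h
    apply h2
    have : b.1 - Pi.single b.2 1 + Pi.single b.2 1 = b.1 + Pi.single b.2 1 + Pi.single b.2 1 := by
      rw [h]
    simpa [sub_add_cancel, add_assoc] using this

/-! ### The torus energy of a configuration supported on one bond -/

omit [MeasurableSpace Circle] [BorelSpace Circle] in
/-- The energy of the torus XY model in the configuration "`ζ` on the bond `{x, x + eᵢ}`, all other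
rotators equal to `1`": `2L² − 7 + cos(θ_y − θ_x) + 3cos θ_x + 3cos θ_y` (`y = x + eᵢ`; the bond itself,
its six outer bonds, and `2L² − 7` aligned far bonds). [folklore] -/
private theorem torusXY_energy_configSplice_pair_one (hL : 3 ≤ L) (x : TorusSite 2 L) (i : Fin 2) (ζ : TorusSite 2 L → Circle) :
    (torusXY 2 L).energy 1 (configSplice {x, x + Pi.single i 1} (ζ, 1)) =
      (2 * (L : ℝ) ^ 2 - 7) +
        ((conj ((ζ x : Circle) : ℂ) * (ζ (x + Pi.single i 1) : ℂ)).re +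
          3 * ((ζ x : Circle) : ℂ).re + 3 * ((ζ (x + Pi.single i 1) : Circle) : ℂ).re) := by
  classical
  set e : TorusSite 2 L := Pi.single i 1 with he
  set y : TorusSite 2 L := x + e with hy
  set S : Finset (TorusSite 2 L) := {x, y} with hS
  have hxy : x ≠ y := by
    intro h; apply torus_single_ne_zero ((by norm_num : (2 : ℕ) ≤ 3).trans hL) i
    have : x + e = x + 0 := by rw [add_zero, ← hy, ← h]
    exact add_left_cancel this
  have hxS : x ∈ S := Finset.mem_insert_self _ _
  have hyS : y ∈ S := Finset.mem_insert_of_mem (Finset.mem_singleton_self _)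
  -- the deviation `δ v = θ̂_v − 1` of the spliced configuration from the aligned one
  set δ : TorusSite 2 L → ℂ := fun v => if v ∈ S then ((ζ v : Circle) : ℂ) - 1 else 0 with hδ
  have hθ : ∀ v, ((configSplice S (ζ, 1) v : Circle) : ℂ) = 1 + δ v := by
    intro v
    by_cases hv : v ∈ S
    · rw [configSplice_apply_of_mem hv, hδ]; simp [hv]
    · rw [configSplice_apply_of_not_mem hv, hδ]; simp [hv]
  -- each bond term
  have hterm : ∀ a : TorusSite 2 L × Fin 2,
      (((torusXY 2 L).bondVar 1 (configSplice S (ζ, 1)) a : Circle) : ℂ).re =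
        1 + (δ a.1).re + (δ (a.1 + Pi.single a.2 1)).re + (conj (δ a.1) * δ (a.1 + Pi.single a.2 1)).re := by
    intro a
    rw [BondSystem.coe_bondVar, torusXY_src_eq, torusXY_tgt_eq, hθ, hθ, Pi.one_apply,
      Circle.coe_one, one_mul]
    simp only [map_add, map_one, Complex.add_re, Complex.mul_re, Complex.one_re, Complex.one_im,
      Complex.add_im, Complex.conj_re, Complex.conj_im]
    ring
  -- sums of `δ` over the torus: supported on `S = {x, y}`
  have hsumδ : ∀ F : TorusSite 2 L → ℂ → ℝ, (∀ v, F v 0 = 0) →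
      ∑ v, F v (δ v) = F x ((ζ x : ℂ) - 1) + F y ((ζ y : ℂ) - 1) := by
    intro F hF
    have : ∀ v, F v (δ v) = if v ∈ S then F v (((ζ v : Circle) : ℂ) - 1) else 0 := by
      intro v; by_cases hv : v ∈ S <;> simp [hδ, hv, hF]
    rw [Finset.sum_congr rfl fun v _ => this v, Finset.sum_ite_mem, Finset.univ_inter, hS,
      Finset.sum_pair hxy]
  -- `δ(x + e_j) = [j = i] (ζ_y − 1)` and `δ(y + e_j) = 0`
  have hδx : ∀ j : Fin 2, δ (x + Pi.single j 1) = if j = i then ((ζ y : Circle) : ℂ) - 1 else 0 := by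
    intro j
    by_cases hji : j = i
    · subst hji
      have : x + Pi.single j 1 ∈ S := by rw [← he, ← hy]; exact hyS
      simp [hδ, this, he, hy]
    · have : x + Pi.single j 1 ∉ S := by
        simp only [hS, Finset.mem_insert, Finset.mem_singleton, not_or]
        refine ⟨fun h => torus_single_ne_zero ((by norm_num : (2 : ℕ) ≤ 3).trans hL) j (add_left_cancel (a := x) (by rw [add_zero]; exact h)),
          fun h => hji ?_⟩
        rw [hy] at h
        exact (torus_single_eq_single_iff hL i j).1 (add_left_cancel h)
      simp [hδ, this, hji]
  have hδy : ∀ j : Fin 2, δ (y + Pi.single j 1) = 0 := by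
    intro j
    have : y + Pi.single j 1 ∉ S := by
      simp only [hS, Finset.mem_insert, Finset.mem_singleton, not_or]
      refine ⟨fun h => torus_single_add_single_ne_zero hL i j ?_,
        fun h => torus_single_ne_zero ((by norm_num : (2 : ℕ) ≤ 3).trans hL) j (add_left_cancel (a := y) (by rw [add_zero]; exact h))⟩
      rw [hy, add_assoc] at h
      exact add_left_cancel (a := x) (by rw [add_zero]; exact h)
    simp [hδ, this]
  -- assemble
  have hcard : (Finset.univ : Finset (TorusSite 2 L)).card = L ^ 2 := by
    rw [Finset.card_univ, Fintype.card_fun, ZMod.card, Fintype.card_fin]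
  unfold BondSystem.energy
  rw [Finset.sum_congr rfl fun a _ => hterm a, Fintype.sum_prod_type_right]
  simp only [Finset.sum_add_distrib, Finset.sum_const, hcard]
  -- the linear terms
  have hlin1 : ∑ z : TorusSite 2 L, (δ z).re = ((ζ x : ℂ).re - 1) + ((ζ y : ℂ).re - 1) := by
    have h := hsumδ (fun _ w => w.re) (fun _ => by simp)
    rw [h, Complex.sub_re, Complex.sub_re, Complex.one_re]
  have hlin2 : ∀ j : Fin 2, ∑ z : TorusSite 2 L, (δ (z + Pi.single j 1)).re =
      ((ζ x : ℂ).re - 1) + ((ζ y : ℂ).re - 1) := by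
    intro j
    rw [show ∑ z : TorusSite 2 L, (δ (z + Pi.single j 1)).re = ∑ z : TorusSite 2 L, (δ z).re from
      Fintype.sum_equiv (Equiv.addRight (Pi.single j 1)) _ _ fun z => rfl]
    exact hlin1
  have hquad : ∀ j : Fin 2, ∑ z : TorusSite 2 L, (conj (δ z) * δ (z + Pi.single j 1)).re =
      if j = i then (conj (((ζ x : Circle) : ℂ) - 1) * (((ζ y : Circle) : ℂ) - 1)).re else 0 := by
    intro j
    have h := hsumδ (fun z w => (conj w * δ (z + Pi.single j 1)).re) (fun _ => by simp)
    rw [h, hδx, hδy]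
    by_cases hji : j = i <;> simp [hji]
  simp only [hlin1, hlin2, hquad, Finset.sum_ite_eq', Finset.mem_univ, if_true,
    Finset.sum_const, Finset.card_univ, Fintype.card_fin]
  simp only [map_sub, map_one, Complex.sub_re, Complex.mul_re, Complex.one_re, Complex.one_im,
    Complex.conj_re, Complex.conj_im, Complex.sub_im, sub_zero]
  ring

/-! ### The wired two-spin system `U(1)²`: one bond of strength `K`, each spin tied to the ghost by `m` bonds -/

/-- The site character `θ ↦ θ_k` of the torus `U(1)^{Fin 2}`. [cite: Ginibre1970, Model 3 p. 322 (plane rotators with ferromagnetic pair couplings)] -/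
def pairSiteChar (k : Fin 2) : (Fin 2 → Circle) →ₜ* Circle where
  toFun θ := θ k
  map_one' := rfl
  map_mul' _ _ := rfl
  continuous_toFun := continuous_apply k

/-- The three characters of the **wired two-spin system**: the bond `θ̄₀θ₁` and the two ghost bonds
`θ₀`, `θ₁` (the ghost spin frozen at `1`). [cite: Ginibre1970, Model 3 p. 322 (plane rotators with ferromagnetic pair couplings)] -/
def wiredPairChar : Fin 3 → (Fin 2 → Circle) →ₜ* Circle :=
  ![diffChar 0 1, pairSiteChar 0, pairSiteChar 1]

/-- The couplings of the wired two-spin system: `K` on the bond, `m·K` on each ghost bond (`m = 3 =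
2d − 1` outer neighbours per endpoint on the square lattice). [cite: Ginibre1970, Model 3 p. 322 (plane rotators with ferromagnetic pair couplings)] -/
def wiredPairCoupling (K : ℝ) (m : ℕ) : Fin 3 → ℝ := ![K, m * K, m * K]

/-- **The wired two-spin energy** `E^{wired}_m(K) = ⟨cos(θ₁ − θ₀)⟩` of two plane rotators coupled with
strength `K` to each other and with strength `m·K` each to a frozen ghost spin:
`E^{wired}_m(K) = ∫∫ cos(a−b) e^{K cos(a−b) + mK(cos a + cos b)} / ∫∫ e^{K cos(a−b) + mK(cos a + cos b)}`
(a Ginibre expectation on `U(1)²`). [cite: Ginibre1970, Model 3 p. 322 (plane rotators with ferromagnetic pair couplings)] -/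
def wiredPairEnergy (K : ℝ) (m : ℕ) : ℝ :=
  ginibreExpect (torusHaar (Fin 2)) wiredPairChar (wiredPairCoupling K m) (reChar (wiredPairChar 0))

omit [MeasurableSpace Circle] [BorelSpace Circle] in
/-- The Ginibre weight of the wired pair in coordinates:
`exp(K cos(θ₁ − θ₀) + mK cos θ₀ + mK cos θ₁)`. [cite: Ginibre1970, Model 3 p. 322 (plane rotators with ferromagnetic pair couplings)] -/
theorem ginibreWeight_wiredPair (K : ℝ) (m : ℕ) (θ : Fin 2 → Circle) :
    ginibreWeight wiredPairChar (wiredPairCoupling K m) θ =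
      Real.exp (K * (conj ((θ 0 : Circle) : ℂ) * (θ 1 : ℂ)).re + m * K * ((θ 0 : Circle) : ℂ).re +
        m * K * ((θ 1 : Circle) : ℂ).re) := by
  rw [ginibreWeight, ginibreHamiltonian, Fin.sum_univ_three]
  simp only [wiredPairCoupling, wiredPairChar, Matrix.cons_val_zero, Matrix.cons_val_one,
    Matrix.cons_val_two, Matrix.head_cons, Matrix.tail_cons, reChar, diffChar_apply, Circle.coe_mul,
    Circle.coe_inv_eq_conj]
  rfl

omit [MeasurableSpace Circle] [BorelSpace Circle] in
/-- The two-point observable of the wired pair in coordinates: `Re(θ̄₀ θ₁)`. [cite: Ginibre1970, Model 3 p. 322 (plane rotators with ferromagnetic pair couplings)] -/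
theorem reChar_wiredPairChar_zero (θ : Fin 2 → Circle) :
    reChar (wiredPairChar 0) θ = (conj ((θ 0 : Circle) : ℂ) * (θ 1 : ℂ)).re := by
  simp only [wiredPairChar, Matrix.cons_val_zero, reChar, diffChar_apply, Circle.coe_mul,
    Circle.coe_inv_eq_conj]

/-- The two-coordinate restriction `ζ ↦ (ζ_x, ζ_y)` of the torus `U(1)^V` to `U(1)^{Fin 2}`, a
continuous homomorphism. [folklore] -/
private def pairRestrict {V : Type*} (x y : V) : (V → Circle) →* (Fin 2 → Circle) where
  toFun ζ := fun k => ζ (![x, y] k)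
  map_one' := rfl
  map_mul' _ _ := rfl

omit [MeasurableSpace Circle] [BorelSpace Circle] in
/-- `pairRestrict x y ζ 0 = ζ x`. [folklore] -/
@[simp] private theorem pairRestrict_apply_zero {V : Type*} (x y : V) (ζ : V → Circle) :
    pairRestrict x y ζ 0 = ζ x := rfl

omit [MeasurableSpace Circle] [BorelSpace Circle] in
/-- `pairRestrict x y ζ 1 = ζ y`. [folklore] -/
@[simp] private theorem pairRestrict_apply_one {V : Type*} (x y : V) (ζ : V → Circle) :
    pairRestrict x y ζ 1 = ζ y := rfl

/-- For `x ≠ y` the two-coordinate restriction **preserves the Haar measures** (a continuous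
surjective homomorphism onto a compact group; i.e. two distinct coordinates of a uniform
configuration are independent uniform angles). [folklore] -/
private theorem measurePreserving_pairRestrict {V : Type*} [Fintype V] [DecidableEq V] {x y : V}
    (hxy : x ≠ y) :
    MeasurePreserving (pairRestrict x y) (torusHaar V) (torusHaar (Fin 2)) := by
  refine MonoidHom.measurePreserving (continuous_pi fun k => continuous_apply _) ?_
    (by rw [measure_univ, measure_univ])
  intro θ
  refine ⟨fun v => if v = x then θ 0 else if v = y then θ 1 else 1, funext fun k => ?_⟩
  fin_cases k
  · simp [pairRestrict]
  · simp [pairRestrict, hxy.symm]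

/-- Change of variables along the two-coordinate restriction, for continuous integrands. [folklore] -/
private theorem integral_comp_pairRestrict {V : Type*} [Fintype V] [DecidableEq V] {x y : V} (hxy : x ≠ y)
    {F : (Fin 2 → Circle) → ℝ} (hF : Continuous F) :
    ∫ ζ, F (pairRestrict x y ζ) ∂torusHaar V = ∫ θ, F θ ∂torusHaar (Fin 2) := by
  have h := measurePreserving_pairRestrict (V := V) hxy
  rw [← integral_map h.measurable.aemeasurable hF.aestronglyMeasurable, h.map_eq]

/-- **The wired expectation on the torus is the wired two-spin energy**: for `L ≥ 3` and the inside set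
`{x, x + eᵢ}` with ghost `x − eᵢ`, `⟨cos(θ_{x+eᵢ} − θ_x)⟩^{wired}_K = E^{wired}_3(K)` — the six outer bonds
of the two endpoints become three ghost bonds each; the `2L² − 7` far bonds contribute a constant
factor that cancels. [cite: Ginibre1970, Model 3 p. 322 (plane rotators with ferromagnetic pair couplings)] -/
theorem expect_wired_pair_eq_wiredPairEnergy (hL : 3 ≤ L) (K : ℝ) (x : TorusSite 2 L) (i : Fin 2) :
    ((torusXY 2 L).wired {x, x + Pi.single i 1} (x - Pi.single i 1)).expect K 1
        (cosDiff x (x + Pi.single i 1)) = wiredPairEnergy K 3 := by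
  classical
  set e : TorusSite 2 L := Pi.single i 1 with he
  set y : TorusSite 2 L := x + e with hy
  set S : Finset (TorusSite 2 L) := {x, y} with hS
  set g : TorusSite 2 L := x - e with hg
  set W := (torusXY 2 L).wired S g with hW
  have hxy : x ≠ y := by
    intro h; apply torus_single_ne_zero ((by norm_num : (2 : ℕ) ≤ 3).trans hL) i
    have : x + e = x + 0 := by rw [add_zero, ← hy, ← h]
    exact add_left_cancel this
  have hxS : x ∈ S := Finset.mem_insert_self _ _
  have hyS : y ∈ S := Finset.mem_insert_of_mem (Finset.mem_singleton_self _)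
  have hgS : g ∉ S := by
    simp only [hS, Finset.mem_insert, Finset.mem_singleton, not_or, hg, hy]
    refine ⟨fun h => torus_single_ne_zero ((by norm_num : (2 : ℕ) ≤ 3).trans hL) i ?_, fun h => torus_single_add_single_ne_zero hL i i ?_⟩
    · have : x - e + e = x + e := by rw [h]
      rw [sub_add_cancel] at this
      exact (add_left_cancel (a := x) (by rw [add_zero]; exact this.symm))
    · have : x - e + e = x + e + e := by rw [h]
      rw [sub_add_cancel, add_assoc] at this
      exact add_left_cancel (a := x) (by rw [add_zero]; exact this.symm)
  -- the wired weight at `configSplice S (ζ, 1)` is a constant times the two-spin Ginibre weight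
  set N : ℕ := (univ.filter fun a : TorusSite 2 L × Fin 2 =>
    ¬((torusXY 2 L).src a ∈ S ∨ (torusXY 2 L).tgt a ∈ S)).card with hN
  set C : ℝ := Real.exp (K * ((2 * (L : ℝ) ^ 2 - 7) - N)) with hC
  have hCpos : 0 < C := Real.exp_pos _
  have hweight : ∀ ζ : TorusSite 2 L → Circle, W.weight K 1 (configSplice S (ζ, 1)) =
      C * ginibreWeight wiredPairChar (wiredPairCoupling K 3) (pairRestrict x y ζ) := by
    intro ζ
    rw [BondSystem.weight, hW, (torusXY 2 L).energy_wired_one hgS, hS, hy, he,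
      torusXY_energy_configSplice_pair_one hL x i ζ, ginibreWeight_wiredPair, hC, ← Real.exp_add]
    congr 1
    simp only [pairRestrict_apply_zero, pairRestrict_apply_one, ← he, ← hy]
    push_cast
    ring
  have hcos : ∀ ζ : TorusSite 2 L → Circle, cosDiff x y (configSplice S (ζ, 1)) =
      reChar (wiredPairChar 0) (pairRestrict x y ζ) := by
    intro ζ
    rw [cosDiff, configSplice_apply_of_mem hxS, configSplice_apply_of_mem hyS, reChar_wiredPairChar_zero,
      pairRestrict_apply_zero, pairRestrict_apply_one]
  -- numerator and denominator
  have hcw : Continuous (ginibreWeight wiredPairChar (wiredPairCoupling K 3)) :=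
    continuous_ginibreWeight _ _
  have hcr : Continuous (reChar (wiredPairChar 0)) := continuous_reChar _
  have hnum : ∫ φ, cosDiff x y φ * W.weight K 1 φ ∂torusHaar (TorusSite 2 L) =
      C * ∫ θ, reChar (wiredPairChar 0) θ * ginibreWeight wiredPairChar (wiredPairCoupling K 3) θ
        ∂torusHaar (Fin 2) := by
    have key := integral_comp_pairRestrict hxy
      (F := fun θ => reChar (wiredPairChar 0) θ * ginibreWeight wiredPairChar (wiredPairCoupling K 3) θ)
      (hcr.mul hcw)
    rw [hW, (torusXY 2 L).integral_cosDiff_mul_weight_wired_eq K hgS hxS hyS 1, ← hW, ← key,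
      ← integral_const_mul]
    refine integral_congr_ae (ae_of_all _ fun ζ => ?_)
    simp only
    rw [hcos, hweight]
    ring
  have hden : ∫ φ, W.weight K 1 φ ∂torusHaar (TorusSite 2 L) =
      C * ∫ θ, ginibreWeight wiredPairChar (wiredPairCoupling K 3) θ ∂torusHaar (Fin 2) := by
    rw [hW, (torusXY 2 L).integral_weight_wired_eq K hgS 1, ← hW,
      ← integral_comp_pairRestrict hxy hcw, ← integral_const_mul]
    exact integral_congr_ae (ae_of_all _ fun ζ => hweight ζ)
  rw [BondSystem.expect, BondSystem.partitionFn, hnum, hden, wiredPairEnergy, ginibreExpect,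
    mul_div_mul_left _ _ hCpos.ne']

/-- **THE WIRED ENERGY CEILING.** For the plane rotator on `(ℤ/Lℤ)²`, `L ≥ 3`, at coupling `K ≥ 0`,
every bond energy satisfies **`E_L(K) ≤ E^{wired}_3(K)`**, the energy of the bond in the two-spin system
in which all `2L² − 2` other rotators are identified with one ghost spin (each endpoint tied to it by
its `3` outer bonds). Uniform in the volume. Proof: wired domination (`expect_cosDiff_le_wired`:
conditioning + Messager–Miracle-Solé–Pfister) and the explicit form of the wired system
(`expect_wired_pair_eq_wiredPairEnergy`). [cite: GarbanSpencer2022, Remark 1 and Appendix Theorem 7.1 (MMP inequality, the input); MessagerMiraclesolePfister1978; Ginibre1970, Model 3 p. 322 and Prop. 3] -/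
theorem torusXYBondEnergy_le_wiredPairEnergy (hL : 3 ≤ L) {K : ℝ} (hK : 0 ≤ K)
    (b : TorusSite 2 L × Fin 2) : torusXYBondEnergy L K b ≤ wiredPairEnergy K 3 := by
  rw [← expect_wired_pair_eq_wiredPairEnergy hL K b.1 b.2]
  exact torusXYBondEnergy_le_expect_wired hL hK b

/-- **The wired stiffness ceiling `βΥ_L(K) ≤ K·E^{wired}_3(K)`** for every `L ≥ 3` and `K ≥ 0`: the
f-sum bound `βΥ_L ≤ K·E_L(K)` (`torusXYStiffness_le_energy`) with the wired energy ceiling. Uniform in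
the volume. [cite: FisherBarberJasnow1973, §II eqs. (2.4)–(2.5); GarbanSpencer2022, Appendix Theorem 7.1] -/
theorem torusXYStiffness_le_mul_wiredPairEnergy (hL : 3 ≤ L) {K : ℝ} (hK : 0 ≤ K) :
    torusXYStiffness L K ≤ K * wiredPairEnergy K 3 :=
  (torusXYStiffness_le_energy K (0, 0)).trans
    (mul_le_mul_of_nonneg_left (torusXYBondEnergy_le_wiredPairEnergy hL hK (0, 0)) hK)

/-- Temperature units: with `K = J/T` (`J, T > 0`), **`Υ_L(T) = T·βΥ_L ≤ J·E^{wired}_3(J/T)`** for every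
`L ≥ 3`. [cite: FisherBarberJasnow1973, §II eqs. (2.4)–(2.5); GarbanSpencer2022, Appendix Theorem 7.1] -/
theorem mul_torusXYStiffness_le_wired (hL : 3 ≤ L) {J T : ℝ} (hJ : 0 < J) (hT : 0 < T) :
    T * torusXYStiffness L (J / T) ≤ J * wiredPairEnergy (J / T) 3 := by
  have hK : 0 ≤ J / T := (div_pos hJ hT).le
  have h := mul_le_mul_of_nonneg_left (torusXYStiffness_le_mul_wiredPairEnergy hL hK) hT.le
  refine h.trans (le_of_eq ?_)
  field_simp

end Torus

/-! ## §5 Properties of the wired two-spin energy and the Kosterlitz–Thouless reading -/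

section Pair

variable [MeasurableSpace Circle] [BorelSpace Circle]

/-- The wired two-spin energy is non-negative (Griffiths' first inequality on `U(1)²`).
[cite: Ginibre1970, Example 4] -/
theorem wiredPairEnergy_nonneg {K : ℝ} (hK : 0 ≤ K) (m : ℕ) : 0 ≤ wiredPairEnergy K m := by
  unfold wiredPairEnergy
  refine ginibreExpect_reChar_nonneg_dual _ _ (fun a => ?_) _
  fin_cases a <;> simp [wiredPairCoupling] <;> positivity

/-- The wired two-spin energy is at most `1`. [cite: Ginibre1970, Model 3 p. 322 (plane rotators with ferromagnetic pair couplings)] -/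
theorem wiredPairEnergy_le_one (K : ℝ) (m : ℕ) : wiredPairEnergy K m ≤ 1 := by
  unfold wiredPairEnergy ginibreExpect
  have hw : Continuous (ginibreWeight wiredPairChar (wiredPairCoupling K m)) :=
    continuous_ginibreWeight _ _
  have hr : Continuous (reChar (wiredPairChar 0)) := continuous_reChar _
  have hZ : 0 < ∫ θ, ginibreWeight wiredPairChar (wiredPairCoupling K m) θ ∂torusHaar (Fin 2) :=
    integral_exp_pos (integrable_torusHaar_of_continuous hw)
  rw [div_le_one hZ]
  refine integral_mono (integrable_torusHaar_of_continuous (hr.mul hw))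
    (integrable_torusHaar_of_continuous hw) fun θ => ?_
  have h1 : reChar (wiredPairChar 0) θ ≤ 1 := (abs_le.1 (abs_reChar_le_one _ θ)).2
  have hwpos : 0 < ginibreWeight wiredPairChar (wiredPairCoupling K m) θ := Real.exp_pos _
  simp only
  nlinarith

/-- **Monotonicity in the coupling** (Ginibre's inequality on `U(1)²`): `0 ≤ K ≤ K'` implies
`E^{wired}_m(K) ≤ E^{wired}_m(K')`. [cite: Ginibre1970, Example 4] -/
theorem wiredPairEnergy_mono {K K' : ℝ} (hK : 0 ≤ K) (hKK' : K ≤ K') (m : ℕ) :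
    wiredPairEnergy K m ≤ wiredPairEnergy K' m := by
  unfold wiredPairEnergy
  refine ginibreExpect_reChar_mono _ surjective_mul_self_torus _ _ (fun a => ?_) (fun a => ?_)
  · fin_cases a <;> simp [wiredPairCoupling] <;> positivity
  · fin_cases a <;> simp [wiredPairCoupling] <;> nlinarith

end Pair

/-! ### The Kosterlitz–Thouless reading: `T_c ≤ J/K₀` whenever `K₀·E^{wired}_3(K₀) < 2/π` -/

section KosterlitzThouless

open Literature.MathematicalPhysics.StatisticalMechanics.KosterlitzThouless

variable [MeasurableSpace Circle] [BorelSpace Circle]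

/-- **Kosterlitz–Thouless bound from the wired ceiling.** Let `ρ` be a stiffness profile obeying the
stability inequality `StableBelow ρ T_c` (`(2/π)T ≤ ρ(T)` on `(0, T_c)`, the RG HYPOTHESIS) with
`T_c > 0`, dominated on `(0, T_c)` by the wired ceiling `ρ(T) ≤ J·E^{wired}_3(J/T)` of the XY model with
coupling `J > 0` (as every limit of finite-volume helicity moduli is, `mul_torusXYStiffness_le_wired`).
If at some `K₀ > 0` the certified inequality `K₀·E^{wired}_3(K₀) < 2/π` holds, then **`T_c ≤ J/K₀`**
(monotonicity of the wired energy in the coupling). [cite: Nelson2002Defects, §2.2.2 eqs. (2.44)–(2.47) (stability inequality, consumed as hypothesis)] -/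
theorem kt_le_of_stableBelow_of_wiredCeiling {ρ : ℝ → ℝ} {Tc J K₀ : ℝ} (hJ : 0 < J) (hTc : 0 < Tc)
    (hK₀ : 0 < K₀) (hst : StableBelow ρ Tc)
    (hceil : ∀ ⦃T : ℝ⦄, 0 < T → T < Tc → ρ T ≤ J * wiredPairEnergy (J / T) 3)
    (hnum : K₀ * wiredPairEnergy K₀ 3 < 2 / Real.pi) : Tc ≤ J / K₀ := by
  by_contra hlt
  push Not at hlt
  -- a temperature strictly between `J/K₀` and `T_c`
  set T := (J / K₀ + Tc) / 2 with hT
  have hJK : 0 < J / K₀ := div_pos hJ hK₀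
  have hT0 : 0 < T := by rw [hT]; positivity
  have hT1 : J / K₀ < T := by rw [hT]; linarith
  have hT2 : T < Tc := by rw [hT]; linarith
  have hKT : J / T ≤ K₀ := by
    rw [div_le_iff₀ hT0]
    have := (div_lt_iff₀ hK₀).1 hT1
    linarith
  have h1 : 2 / Real.pi * T ≤ J * wiredPairEnergy K₀ 3 :=
    (hst hT0 hT2).trans ((hceil hT0 hT2).trans
      (mul_le_mul_of_nonneg_left (wiredPairEnergy_mono (div_pos hJ hT0).le hKT 3) hJ.le))
  have h2 : J * wiredPairEnergy K₀ 3 < 2 / Real.pi * (J / K₀) := by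
    have := mul_lt_mul_of_pos_left hnum (div_pos hJ hK₀)
    calc J * wiredPairEnergy K₀ 3 = J / K₀ * (K₀ * wiredPairEnergy K₀ 3) := by
          field_simp
      _ < J / K₀ * (2 / Real.pi) := this
      _ = 2 / Real.pi * (J / K₀) := by ring
  have h3 : 2 / Real.pi * T < 2 / Real.pi * (J / K₀) := h1.trans_lt h2
  have hπ : 0 < 2 / Real.pi := by positivity
  exact absurd (lt_of_mul_lt_mul_left h3 hπ.le) (not_lt.2 hT1.le)

/-- **The bound from finite-volume helicity moduli.** If the stiffness profile `ρ` is, at every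
temperature `0 < T < T_c`, the limit of the finite-volume helicity moduli `Υ_{L_n}(T) = T·βΥ_{L_n}(J/T)`
of the XY model on tori `(ℤ/L_nℤ)²`, `L_n ≥ 3` (any sequence), then under `StableBelow ρ T_c` and a
certified `K₀·E^{wired}_3(K₀) < 2/π`: **`T_c ≤ J/K₀`**. [cite: Nelson2002Defects, §2.2.2 eqs. (2.44)–(2.47) (stability inequality, consumed as hypothesis); FisherBarberJasnow1973, §II] -/
theorem kt_le_of_stableBelow_of_tendsto_torusXYStiffness_wired {ρ : ℝ → ℝ} {Tc J K₀ : ℝ}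
    (hJ : 0 < J) (hTc : 0 < Tc) (hK₀ : 0 < K₀) (hst : StableBelow ρ Tc)
    (Ls : ℕ → ℕ) [∀ n, NeZero (Ls n)] (hLs : ∀ n, 3 ≤ Ls n)
    (hlim : ∀ ⦃T : ℝ⦄, 0 < T → T < Tc →
      Tendsto (fun n => T * torusXYStiffness (Ls n) (J / T)) atTop (𝓝 (ρ T)))
    (hnum : K₀ * wiredPairEnergy K₀ 3 < 2 / Real.pi) : Tc ≤ J / K₀ :=
  kt_le_of_stableBelow_of_wiredCeiling hJ hTc hK₀ hst (fun _ hT hTlt =>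
    le_of_tendsto' (hlim hT hTlt) fun n => mul_torusXYStiffness_le_wired (hLs n) hJ hT) hnum

end KosterlitzThouless

end Literature.Probability.LatticeModels
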